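import Summits.QuantumFields.YangMills.Theorems.FlatTubeReductionTransportStepPairDifference
import Summits.QuantumFields.YangMills.Theorems.LuscherReductionTwistedTraceScalingBTOffDiagonalBound
import HarnessLib

/-!
# The off-diagonal MAGNETIC term for a NEAR PAIR with the cubic remainder DIFFERENCED: `|offMag(u,u';v')| ≤ 100σN‖v̂'‖² + 10080αN‖v̂'‖² + N_pl(58752t³ + 1401138t⁴ + 10⁷·α·t²)`
# — lane A's `2·stepActionErr t σ ∋ 2·N_pl·1728t²√σ` replaced by `10⁷·N_pl·α·t²` — and the pointwise bound on `offX` that follows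
# (route `FlatTubeReduction`, crux K1 `NearFlatRatioLaw` stmt-QuantumFields-24720; seat `ym-line-ftr-p1` g16; rate twin «ratepack»; R2b1 RECORD rung — no summit statement is proved here)

WHY (NOTES g16 «NP-L»).  In lane A's `…BTOffDiagonalBound.abs_offMagnetic_le` the anharmonic remainder of the Wilson action on the tube, `R(v'; u) = S(oT u v') − L³S₁(u) − Σ_p c_p|(D_u v̂')_p|²`
(the linear term vanishes for balanced `v'`), is bounded at `u` and at `u'` SEPARATELY by `stepActionErr t σ = N_pl(1728t²√σ + 29376t³ + 700569t⁴)`.  The `1728t²√σ` piece is the cubic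
cross term `2(vecPart X_p − (D w)_p)·F_p` (`|vecPart X_p − D w| ≤ 288t²`, `|F_p| ≤ √σ`); at the rate twin's scales (`βt² = 1`, `√σ ≍ δ² ≍ λ_b`) it is the ONLY term of the symmetric near-pair
rate `η_s` with zero margin, and it pins the profile radius to `β^{-1/2}` (memo `Lines/ratepack-v4-moments-g15.md` §2).  But `offX(u,u')` only sees the DIFFERENCE `R(v';u') − R(v';u)`,
and `…TransportStepPairDifference.transportStep_constLift_pair_diff` makes the cross term Lipschitz in the slow datum: `|Δ(vecPart X_p − D w)| ≤ 995976·α·t²` and `|ΔF_p| ≤ 100α`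
(`α` = size of the relative rotations `u_ku'_k⁻¹`, `≍ β^{-1/2}√log β` for a near pair).  Result: the `t²√σ` term becomes `α·t²` — affordable at any profile radius `t = β^{-1/2}·polylog(β)`.
* §1 `abs_plaqCurv_constLift_pair_le` — `|F_p(constLift u') − F_p(constLift u)|_c ≤ 100α` (exact transport identity `hol(W·U) = X·hol(U)` for the constant step `u'u⁻¹`);
* §2 `plaq_anharmonic_le` (the `t³`, `t⁴` pieces at one slow datum), `plaq_remainder_pair_le` (per plaquette: `≤ 58752t³ + 1401138t⁴ + 10⁷αt²`);
* §3 `abs_weightedStiffness_pair_le` — `|Σ_p c'_p|(D_{u'}w)_p|² − Σ_p c_p|(D_u w)_p|²| ≤ 100σN‖w‖² + 10080αN‖w‖²`;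
* §4 ★★ `abs_offMagnetic_le_near`; §5 ★★★ `abs_offX_le_near` — `abs_offX_le` (split radii as in `…SymmetricCorePair.abs_offX_le_split`) with the new magnetic bound.
HONEST FRAMING: fixed-lattice quaternion/real algebra for a stub of the CONDITIONAL reduction route R2b1 (rate twin); femto rung R2b1 (RECORD label); not infinite volume, not a gap,
not Clay.  No defs, no named facts, no `sorry`.
-/

set_option autoImplicit false

noncomputable section

open MeasureTheory Filter Topology Real
open scoped BigOperators Matrix InnerProductSpace RealInnerProductSpace
open Literature.MathematicalPhysics.QuantumFieldTheory
open Literature.MathematicalPhysics.QuantumLattice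

namespace Summit.QuantumFields.YangMills.Theorems.FemtoTransferGap.TwoLattice.ConstTube

open Summit.QuantumFields.YangMills.Theorems.FemtoTransferGap
open Summit.QuantumFields.YangMills.Theorems.FemtoTransferGap.TwoLattice
open Summit.QuantumFields.YangMills.Theorems.FemtoTransferGap.TwoLattice.Avg
open Summit.QuantumFields.YangMills.Theorems.FemtoTransferGap.TwoLattice.Stiff
open Summit.QuantumFields.YangMills.Theorems.FemtoTransferGap.TwoLattice.Cov
open Summit.QuantumFields.YangMills.Theorems.FemtoTransferGap.TwoLattice.Toron

variable {L : ℕ} [NeZero L]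

/-! ## §1 The plaquette curvature of the slow manifold is Lipschitz in the slow datum -/

omit [NeZero L] in
/-- The constant step from `u` to `u'`: `constLift(u'u⁻¹)·constLift u = constLift u'`. [folklore] -/
theorem constLift_step_mul (u u' : GaugeConfig 3 1 SU2) : constLift L (fun e => u' e * (u e)⁻¹) * constLift L u = constLift L u' := by
  rw [← constLift_mul]; congr 1; funext e; simp only [Pi.mul_apply, inv_mul_cancel_right]

omit [NeZero L] in
/-- ★ `|F_p(constLift u')_c − F_p(constLift u)_c| ≤ 100α` when `|vecPart(u_ku'_k⁻¹)_c| ≤ α ≤ 1/30` and `u₀(u_ku'_k⁻¹) ≥ 0`: by the exact transport identity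
`hol_p(W·U) = X_p(W;U)·hol_p(U)` for the constant step `W = constLift(u'u⁻¹)` (`|vecPart X_p| ≤ 24α`, `1 − u₀X_p ≤ 837α²`) and `(X·h)⃗ = X₀h⃗ + h₀x⃗ + x⃗ × h⃗`. [cite: Luscher1983, §3] -/
theorem abs_plaqCurv_constLift_pair_le (u u' : GaugeConfig 3 1 SU2) {α : ℝ} (hα : α ≤ 1 / 30)
    (ha : ∀ (k : Fin 3) (c : Fin 3), |vecPart (u (0, k) * (u' (0, k))⁻¹) c| ≤ α) (hw0 : ∀ k, 0 ≤ scalarPart (u (0, k) * (u' (0, k))⁻¹))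
    (p : Plaquette 3 L) (c : Fin 3) :
    |vecPart (hol (constLift L u') p) c - vecPart (hol (constLift L u) p) c| ≤ 100 * α := by
  have hα0 : 0 ≤ α := (abs_nonneg _).trans (ha 0 0)
  set W : GaugeConfig 3 L SU2 := constLift L (fun e => u' e * (u e)⁻¹) with hW
  have hs : ∀ e : Edge 3 L, 0 ≤ scalarPart (W e) := fun e => by
    rw [hW, constLift_apply, show u' (0, e.2) * (u (0, e.2))⁻¹ = (u (0, e.2) * (u' (0, e.2))⁻¹)⁻¹ by rw [mul_inv_rev, inv_inv], scalarPart_inv]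
    exact hw0 e.2
  have hwv : ∀ (e : Edge 3 L) (c : Fin 3), |vecPart (W e) c| ≤ α := fun e c => by
    rw [hW, constLift_apply, show u' (0, e.2) * (u (0, e.2))⁻¹ = (u (0, e.2) * (u' (0, e.2))⁻¹)⁻¹ by rw [mul_inv_rev, inv_inv], vecPart_inv, Pi.neg_apply, abs_neg]
    exact ha e.2 c
  obtain ⟨-, bX, sX, aX⟩ := transportStep_bounds W (constLift L u) hα hs hwv p
  have hhol : hol (constLift L u') p = transportStep W (constLift L u) p * hol (constLift L u) p := by
    rw [← constLift_step_mul u u', hol_mul_eq_transportStep_mul]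
  set X := transportStep W (constLift L u) p with hX
  set h := hol (constLift L u) p with hh
  rw [hhol, vecPart_mul]
  simp only [Pi.add_apply, Pi.smul_apply, smul_eq_mul]
  have e : scalarPart X * vecPart h c + scalarPart h * vecPart X c + (vecPart X ⨯₃ vecPart h) c - vecPart h c =
      (scalarPart X - 1) * vecPart h c + scalarPart h * vecPart X c + (vecPart X ⨯₃ vecPart h) c := by ring
  rw [e]
  have hX1 : scalarPart X ≤ 1 := (abs_le.mp (abs_scalarPart_le X)).2
  have h1 : |(scalarPart X - 1) * vecPart h c| ≤ 837 * α ^ 2 := by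
    rw [abs_mul]
    calc |scalarPart X - 1| * |vecPart h c| ≤ (837 * α ^ 2) * 1 :=
          mul_le_mul (by rw [abs_sub_comm, abs_of_nonneg (by linarith)]; exact aX) (abs_vecPart_le_one h c) (abs_nonneg _) (by positivity)
      _ = 837 * α ^ 2 := mul_one _
  have h2 : |scalarPart h * vecPart X c| ≤ 24 * α := by
    rw [abs_mul]
    calc |scalarPart h| * |vecPart X c| ≤ 1 * (24 * α) := mul_le_mul (abs_scalarPart_le h) (bX c) (abs_nonneg _) zero_le_one
      _ = 24 * α := one_mul _
  have h3 : |(vecPart X ⨯₃ vecPart h) c| ≤ 2 * (24 * α) * 1 := abs_cross_apply_le bX (fun b => abs_vecPart_le_one h b) c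
  have h4 : 837 * α ^ 2 ≤ 28 * α := by nlinarith
  have := abs_add_le ((scalarPart X - 1) * vecPart h c + scalarPart h * vecPart X c) ((vecPart X ⨯₃ vecPart h) c)
  have := abs_add_le ((scalarPart X - 1) * vecPart h c) (scalarPart h * vecPart X c)
  linarith

/-! ## §2 The anharmonic remainder per plaquette: crude at one slow datum, differenced for the cross term -/

/-- The `t³`/`t⁴` pieces of the per-plaquette remainder at ONE configuration `U` with `S(U) ≤ σ < 2` (as inside lane A's `abs_wilsonAction_step_sub_quadratic_le`):
`|c_p(Σ_c x_c² − Σ_c D_c²) + c_p(1 − u₀X_p)²| ≤ 29376t³ + 700569t⁴`. [cite: Luscher1983, §3] -/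
theorem plaq_anharmonic_le (W U : GaugeConfig 3 L SU2) {τ σ : ℝ} (hτ : τ ≤ 1 / 30) (hσ : σ < 2) (hS : wilsonAction su2Rep U ≤ σ)
    (hs : ∀ e : Edge 3 L, 0 ≤ scalarPart (W e)) (hw : ∀ (e : Edge 3 L) (c : Fin 3), |vecPart (W e) c| ≤ τ) (p : Plaquette 3 L) :
    |scalarPart (hol U p) * (∑ c, vecPart (transportStep W U p) c ^ 2 - ∑ c, covCurl U (linkVec L W) (p, c) ^ 2) +
        scalarPart (hol U p) * (1 - scalarPart (transportStep W U p)) ^ 2| ≤ 29376 * τ ^ 3 + 700569 * τ ^ 4 := by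
  have hτ0 : 0 ≤ τ := (abs_nonneg _).trans (hw ((0 : Site 3 L), 0) 0)
  obtain ⟨dX, bX, sX, aX⟩ := transportStep_bounds W U hτ hs hw p
  obtain ⟨hH, -⟩ := hol_hypotheses_of_wilsonAction_le U hσ hS p
  set X := transportStep W U p with hXdef
  set cp := scalarPart (hol U p) with hcp
  set D := covCurl U (linkVec L W) with hD
  have hcp1 : cp ≤ 1 := by
    have h := scalarPart_sq_add (hol U p)
    have h2 : 0 ≤ ∑ a, vecPart (hol U p) a ^ 2 := Finset.sum_nonneg fun a _ => sq_nonneg _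
    nlinarith
  have hDb : ∀ c, |D (p, c)| ≤ 10 * τ := fun c => abs_covCurl_apply_le U (w := linkVec L W) (fun e b => by rw [linkVec_apply]; exact hw e b) (p, c)
  have hsq : |∑ c, vecPart X c ^ 2 - ∑ c, D (p, c) ^ 2| ≤ 29376 * τ ^ 3 := by
    rw [← Finset.sum_sub_distrib]
    have hc : ∀ c, |vecPart X c ^ 2 - D (p, c) ^ 2| ≤ 288 * τ ^ 2 * (34 * τ) := fun c => by
      have e : vecPart X c ^ 2 - D (p, c) ^ 2 = (vecPart X c - D (p, c)) * (vecPart X c + D (p, c)) := by ring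
      rw [e, abs_mul]
      refine mul_le_mul (dX c) ((abs_add_le _ _).trans (by linarith [bX c, hDb c])) (abs_nonneg _) (by positivity)
    calc |∑ c, (vecPart X c ^ 2 - D (p, c) ^ 2)| ≤ ∑ c, |vecPart X c ^ 2 - D (p, c) ^ 2| := Finset.abs_sum_le_sum_abs _ _
      _ ≤ ∑ _c : Fin 3, 288 * τ ^ 2 * (34 * τ) := Finset.sum_le_sum fun c _ => hc c
      _ = 29376 * τ ^ 3 := by simp; ring
  have t1 : |cp * (∑ c, vecPart X c ^ 2 - ∑ c, D (p, c) ^ 2)| ≤ 29376 * τ ^ 3 := by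
    rw [abs_mul, abs_of_nonneg hH]
    calc cp * |∑ c, vecPart X c ^ 2 - ∑ c, D (p, c) ^ 2| ≤ 1 * (29376 * τ ^ 3) := mul_le_mul hcp1 hsq (abs_nonneg _) zero_le_one
      _ = 29376 * τ ^ 3 := one_mul _
  have t2 : |cp * (1 - scalarPart X) ^ 2| ≤ 700569 * τ ^ 4 := by
    rw [abs_mul, abs_of_nonneg hH, abs_of_nonneg (sq_nonneg _)]
    have h0 : 0 ≤ 1 - scalarPart X := by
      have h := scalarPart_sq_add X
      have h2 : 0 ≤ ∑ a, vecPart X a ^ 2 := Finset.sum_nonneg fun a _ => sq_nonneg _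
      nlinarith
    calc cp * (1 - scalarPart X) ^ 2 ≤ 1 * (837 * τ ^ 2) ^ 2 := mul_le_mul hcp1 (pow_le_pow_left₀ h0 aX 2) (sq_nonneg _) zero_le_one
      _ = 700569 * τ ^ 4 := by ring
  exact (abs_add_le _ _).trans (add_le_add t1 t2)

omit [NeZero L] in
/-- The per-plaquette remainder `R_p(U) := [2(1 − u₀X_p)c_p + 2x_p·F_p] − 2Σ_c D_c F_c − c_pΣ_c D_c²` as `c_p(Σx² − ΣD²) + c_p(1−u₀X)² + 2(x − D)·F` (the algebra of lane A's expansion).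
[cite: Luscher1983, §3] -/
theorem plaq_remainder_eq (W U : GaugeConfig 3 L SU2) (p : Plaquette 3 L) :
    (2 * (1 - scalarPart (transportStep W U p)) * scalarPart (hol U p) + 2 * (vecPart (transportStep W U p) ⬝ᵥ vecPart (hol U p)))
        - 2 * ∑ c, covCurl U (linkVec L W) (p, c) * plaqCurv U (p, c) - scalarPart (hol U p) * ∑ c, covCurl U (linkVec L W) (p, c) ^ 2 =
      scalarPart (hol U p) * (∑ c, vecPart (transportStep W U p) c ^ 2 - ∑ c, covCurl U (linkVec L W) (p, c) ^ 2) +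
        scalarPart (hol U p) * (1 - scalarPart (transportStep W U p)) ^ 2 +
        2 * ((fun c => vecPart (transportStep W U p) c - covCurl U (linkVec L W) (p, c)) ⬝ᵥ vecPart (hol U p)) := by
  have hquad := two_mul_one_sub_scalarPart_eq (transportStep W U p)
  have e : vecPart (transportStep W U p) ⬝ᵥ vecPart (hol U p) - ∑ c, covCurl U (linkVec L W) (p, c) * plaqCurv U (p, c) =
      (fun c => vecPart (transportStep W U p) c - covCurl U (linkVec L W) (p, c)) ⬝ᵥ vecPart (hol U p) := by
    simp only [dotProduct, plaqCurv_apply, ← Finset.sum_sub_distrib]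
    exact Finset.sum_congr rfl fun c _ => by ring
  rw [← e, hquad]; ring

/-- ★ **The per-plaquette remainder, DIFFERENCED between two near slow data** `U = constLift u`, `U' = constLift u'` (`S(U), S(U') ≤ σ < 2`, step `W` with `|vecPart W_e|_c ≤ t ≤ 1/30`,
`u₀(W_e) ≥ 0`, relative rotations `|vecPart(u_ku'_k⁻¹)|_c ≤ α ≤ 1/30` with `u₀ ≥ 0`): `|R_p(U') − R_p(U)| ≤ 58752t³ + 1401138t⁴ + 10⁷·α·t²`. [cite: Luscher1983, §3] -/
theorem plaq_remainder_pair_le (u u' : GaugeConfig 3 1 SU2) (W : GaugeConfig 3 L SU2) {τ σ α : ℝ} (hτ : τ ≤ 1 / 30) (hσ : σ < 2)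
    (hS : wilsonAction su2Rep (constLift L u) ≤ σ) (hS' : wilsonAction su2Rep (constLift L u') ≤ σ)
    (hs : ∀ e : Edge 3 L, 0 ≤ scalarPart (W e)) (hw : ∀ (e : Edge 3 L) (c : Fin 3), |vecPart (W e) c| ≤ τ) (hα : α ≤ 1 / 30)
    (ha : ∀ (k : Fin 3) (c : Fin 3), |vecPart (u (0, k) * (u' (0, k))⁻¹) c| ≤ α) (hw0 : ∀ k, 0 ≤ scalarPart (u (0, k) * (u' (0, k))⁻¹)) (p : Plaquette 3 L) :
    |((2 * (1 - scalarPart (transportStep W (constLift L u') p)) * scalarPart (hol (constLift L u') p) +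
          2 * (vecPart (transportStep W (constLift L u') p) ⬝ᵥ vecPart (hol (constLift L u') p)))
        - 2 * ∑ c, covCurl (constLift L u') (linkVec L W) (p, c) * plaqCurv (constLift L u') (p, c)
        - scalarPart (hol (constLift L u') p) * ∑ c, covCurl (constLift L u') (linkVec L W) (p, c) ^ 2) -
      ((2 * (1 - scalarPart (transportStep W (constLift L u) p)) * scalarPart (hol (constLift L u) p) +
          2 * (vecPart (transportStep W (constLift L u) p) ⬝ᵥ vecPart (hol (constLift L u) p)))
        - 2 * ∑ c, covCurl (constLift L u) (linkVec L W) (p, c) * plaqCurv (constLift L u) (p, c)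
        - scalarPart (hol (constLift L u) p) * ∑ c, covCurl (constLift L u) (linkVec L W) (p, c) ^ 2)| ≤
      58752 * τ ^ 3 + 1401138 * τ ^ 4 + 10000000 * α * τ ^ 2 := by
  have hτ0 : 0 ≤ τ := (abs_nonneg _).trans (hw ((0 : Site 3 L), 0) 0)
  have hα0 : 0 ≤ α := (abs_nonneg _).trans (ha 0 0)
  have hσ0 : 0 ≤ σ := (wilsonAction_su2_nonneg_lat (constLift L u)).trans hS
  rw [plaq_remainder_eq, plaq_remainder_eq]
  have hA := plaq_anharmonic_le W (constLift L u) hτ hσ hS hs hw p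
  have hA' := plaq_anharmonic_le W (constLift L u') hτ hσ hS' hs hw p
  -- the cross term, differenced
  obtain ⟨dX, -, -, -⟩ := transportStep_bounds W (constLift L u) hτ hs hw p
  obtain ⟨-, hF'⟩ := hol_hypotheses_of_wilsonAction_le (constLift L u') hσ hS' p
  obtain ⟨dd, -, -⟩ := RateTube.transportStep_constLift_pair_diff u u' W hτ (by linarith) hs hw ha p
  have hΔF : ∀ c, |(vecPart (hol (constLift L u') p) - vecPart (hol (constLift L u) p)) c| ≤ 100 * α := fun c => by
    rw [Pi.sub_apply]; exact abs_plaqCurv_constLift_pair_le u u' hα ha hw0 p c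
  have hsqrt : Real.sqrt σ ≤ 3 / 2 := by
    rw [show (3 / 2 : ℝ) = Real.sqrt ((3 / 2) ^ 2) by rw [Real.sqrt_sq]; norm_num]
    exact Real.sqrt_le_sqrt (by nlinarith)
  -- `(x' − D')·F' − (x − D)·F = ((x'−D') − (x−D))·F' + (x−D)·(F' − F)`
  set a' : Fin 3 → ℝ := fun c => vecPart (transportStep W (constLift L u') p) c - covCurl (constLift L u') (linkVec L W) (p, c) with ha'
  set a : Fin 3 → ℝ := fun c => vecPart (transportStep W (constLift L u) p) c - covCurl (constLift L u) (linkVec L W) (p, c) with haa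
  have e : a' ⬝ᵥ vecPart (hol (constLift L u') p) - a ⬝ᵥ vecPart (hol (constLift L u) p) =
      (a' - a) ⬝ᵥ vecPart (hol (constLift L u') p) + a ⬝ᵥ (vecPart (hol (constLift L u') p) - vecPart (hol (constLift L u) p)) := by
    simp only [sub_dotProduct, dotProduct_sub]; ring
  have hd : ∀ c, |(a' - a) c| ≤ 995976 * α * τ ^ 2 := fun c => by
    rw [Pi.sub_apply, ha', haa, abs_sub_comm]; exact dd c
  have c1 : |(a' - a) ⬝ᵥ vecPart (hol (constLift L u') p)| ≤ 3 * (995976 * α * τ ^ 2) * Real.sqrt σ := abs_dot_le hd hF'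
  have c2 : |a ⬝ᵥ (vecPart (hol (constLift L u') p) - vecPart (hol (constLift L u) p))| ≤ 3 * (288 * τ ^ 2) * (100 * α) := abs_dot_le dX hΔF
  have hcross : |2 * (a' ⬝ᵥ vecPart (hol (constLift L u') p)) - 2 * (a ⬝ᵥ vecPart (hol (constLift L u) p))| ≤ 10000000 * α * τ ^ 2 := by
    rw [← mul_sub, e, abs_mul, abs_two]
    have := abs_add_le ((a' - a) ⬝ᵥ vecPart (hol (constLift L u') p)) (a ⬝ᵥ (vecPart (hol (constLift L u') p) - vecPart (hol (constLift L u) p)))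
    have hατ : 0 ≤ α * τ ^ 2 := by positivity
    nlinarith [mul_le_mul_of_nonneg_left hsqrt (by positivity : (0 : ℝ) ≤ 3 * (995976 * α * τ ^ 2))]
  -- assemble
  have hsplit : ∀ (A₁ A₂ B₁ B₂ C₁ C₂ : ℝ), (A₁ + A₂ + C₁) - (B₁ + B₂ + C₂) = (A₁ + A₂) - (B₁ + B₂) + (C₁ - C₂) := fun _ _ _ _ _ _ => by ring
  rw [hsplit]
  refine (abs_add_le _ _).trans ?_
  have := abs_sub (scalarPart (hol (constLift L u') p) * (∑ c, vecPart (transportStep W (constLift L u') p) c ^ 2 - ∑ c, covCurl (constLift L u') (linkVec L W) (p, c) ^ 2) +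
      scalarPart (hol (constLift L u') p) * (1 - scalarPart (transportStep W (constLift L u') p)) ^ 2)
    (scalarPart (hol (constLift L u) p) * (∑ c, vecPart (transportStep W (constLift L u) p) c ^ 2 - ∑ c, covCurl (constLift L u) (linkVec L W) (p, c) ^ 2) +
      scalarPart (hol (constLift L u) p) * (1 - scalarPart (transportStep W (constLift L u) p)) ^ 2)
  linarith

/-! ## §3 The weighted stiffness at two near slow data -/

/-- ★ `|Σ_p c_p(U')|(D_{U'}w)_p|² − Σ_p c_p(U)|(D_U w)_p|²| ≤ 100σN‖w‖² + 10080αN‖w‖²` for `U = constLift u`, `U' = constLift u'` with `S ≤ σ < 2` and relative rotations `≤ α ≤ 1`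
(`N = |P × Fin 3|`; Lipschitz lemma `norm_covCurl_step_sub_le` along the constant step, `weighted_stiffness_bounds`). [cite: Luscher1983, §3] -/
theorem abs_weightedStiffness_pair_le (u u' : GaugeConfig 3 1 SU2) (w : LinkSpace L) {σ α : ℝ}
    (hS : wilsonAction su2Rep (constLift L u) ≤ σ) (hS' : wilsonAction su2Rep (constLift L u') ≤ σ) (hα1 : α ≤ 1)
    (ha : ∀ (k : Fin 3) (c : Fin 3), |vecPart (u (0, k) * (u' (0, k))⁻¹) c| ≤ α) :
    |∑ p : Plaquette 3 L, scalarPart (hol (constLift L u') p) * ∑ c, covCurl (constLift L u') w (p, c) ^ 2 -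
        ∑ p : Plaquette 3 L, scalarPart (hol (constLift L u) p) * ∑ c, covCurl (constLift L u) w (p, c) ^ 2| ≤
      100 * σ * (Fintype.card (Plaquette 3 L × Fin 3) : ℝ) * ‖w‖ ^ 2 + 10080 * α * (Fintype.card (Plaquette 3 L × Fin 3) : ℝ) * ‖w‖ ^ 2 := by
  have hα0 : 0 ≤ α := (abs_nonneg _).trans (ha 0 0)
  have hσ0 : 0 ≤ σ := (wilsonAction_su2_nonneg_lat (constLift L u)).trans hS
  have hN0 : (0 : ℝ) ≤ Fintype.card (Plaquette 3 L × Fin 3) := Nat.cast_nonneg _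
  have hsN : Real.sqrt (Fintype.card (Plaquette 3 L × Fin 3) : ℝ) * Real.sqrt (Fintype.card (Plaquette 3 L × Fin 3) : ℝ) = Fintype.card (Plaquette 3 L × Fin 3) :=
    Real.mul_self_sqrt hN0
  obtain ⟨lo, hi⟩ := weighted_stiffness_bounds (constLift L u) hS w
  obtain ⟨lo', hi'⟩ := weighted_stiffness_bounds (constLift L u') hS' w
  have hD := norm_covCurl_le_op (constLift L u) w
  have hD' := norm_covCurl_le_op (constLift L u') w
  have hwv : ∀ (e : Edge 3 L) (c : Fin 3), |vecPart (constLift L (fun e => u' e * (u e)⁻¹) e) c| ≤ α := fun e c => by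
    rw [constLift_apply, show u' (0, e.2) * (u (0, e.2))⁻¹ = (u (0, e.2) * (u' (0, e.2))⁻¹)⁻¹ by rw [mul_inv_rev, inv_inv], vecPart_inv, Pi.neg_apply, abs_neg]
    exact ha e.2 c
  have hL := norm_covCurl_step_sub_le (constLift L u) hα1 hwv w
  rw [constLift_step_mul] at hL
  have hsq : |‖covCurl (constLift L u') w‖ ^ 2 - ‖covCurl (constLift L u) w‖ ^ 2| ≤ 10080 * α * (Fintype.card (Plaquette 3 L × Fin 3) : ℝ) * ‖w‖ ^ 2 := by
    have e1 : ‖covCurl (constLift L u') w‖ ^ 2 - ‖covCurl (constLift L u) w‖ ^ 2 =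
        (‖covCurl (constLift L u') w‖ - ‖covCurl (constLift L u) w‖) * (‖covCurl (constLift L u') w‖ + ‖covCurl (constLift L u) w‖) := by ring
    have e2 := (abs_norm_sub_norm_le (covCurl (constLift L u') w) (covCurl (constLift L u) w)).trans hL
    rw [e1, abs_mul, abs_of_nonneg (by positivity : (0 : ℝ) ≤ ‖covCurl (constLift L u') w‖ + ‖covCurl (constLift L u) w‖)]
    refine (mul_le_mul e2 (add_le_add hD' hD) (by positivity) (by positivity)).trans ?_
    have e3 : 504 * α * Real.sqrt (Fintype.card (Plaquette 3 L × Fin 3) : ℝ) * ‖w‖ *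
        (10 * Real.sqrt (Fintype.card (Plaquette 3 L × Fin 3) : ℝ) * ‖w‖ + 10 * Real.sqrt (Fintype.card (Plaquette 3 L × Fin 3) : ℝ) * ‖w‖) =
        10080 * α * (Real.sqrt (Fintype.card (Plaquette 3 L × Fin 3) : ℝ) * Real.sqrt (Fintype.card (Plaquette 3 L × Fin 3) : ℝ)) * ‖w‖ ^ 2 := by ring
    rw [e3, hsN]
  have hD2 : ‖covCurl (constLift L u) w‖ ^ 2 ≤ 100 * (Fintype.card (Plaquette 3 L × Fin 3) : ℝ) * ‖w‖ ^ 2 := by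
    have h := pow_le_pow_left₀ (norm_nonneg _) hD 2
    have e : (10 * Real.sqrt (Fintype.card (Plaquette 3 L × Fin 3) : ℝ) * ‖w‖) ^ 2 =
        100 * (Real.sqrt (Fintype.card (Plaquette 3 L × Fin 3) : ℝ) * Real.sqrt (Fintype.card (Plaquette 3 L × Fin 3) : ℝ)) * ‖w‖ ^ 2 := by ring
    rw [e, hsN] at h; exact h
  have hD'2 : ‖covCurl (constLift L u') w‖ ^ 2 ≤ 100 * (Fintype.card (Plaquette 3 L × Fin 3) : ℝ) * ‖w‖ ^ 2 := by
    have h := pow_le_pow_left₀ (norm_nonneg _) hD' 2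
    have e : (10 * Real.sqrt (Fintype.card (Plaquette 3 L × Fin 3) : ℝ) * ‖w‖) ^ 2 =
        100 * (Real.sqrt (Fintype.card (Plaquette 3 L × Fin 3) : ℝ) * Real.sqrt (Fintype.card (Plaquette 3 L × Fin 3) : ℝ)) * ‖w‖ ^ 2 := by ring
    rw [e, hsN] at h; exact h
  have hC := abs_le.mp hsq
  have hσD : σ / 2 * ‖covCurl (constLift L u) w‖ ^ 2 ≤ σ / 2 * (100 * (Fintype.card (Plaquette 3 L × Fin 3) : ℝ) * ‖w‖ ^ 2) :=
    mul_le_mul_of_nonneg_left hD2 (by linarith)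
  have hσD' : σ / 2 * ‖covCurl (constLift L u') w‖ ^ 2 ≤ σ / 2 * (100 * (Fintype.card (Plaquette 3 L × Fin 3) : ℝ) * ‖w‖ ^ 2) :=
    mul_le_mul_of_nonneg_left hD'2 (by linarith)
  have hpos : 0 ≤ 100 * σ * (Fintype.card (Plaquette 3 L × Fin 3) : ℝ) * ‖w‖ ^ 2 := by positivity
  rw [abs_le]
  constructor <;> nlinarith

/-! ## §4 ★★ The off-diagonal magnetic term for a near pair -/

/-- ★★ **The off-diagonal magnetic term, near-pair form**: for `v'` cap-balanced with `|v'_{e,c}| ≤ t ≤ 1/30`, `L³S₁(u), L³S₁(u') ≤ σ < 2`, relative rotations `|vecPart(u_ku'_k⁻¹)|_c ≤ α ≤ 1/30`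
with `u₀(u_ku'_k⁻¹) ≥ 0`: `|(S(oT u' v') − L³S₁u') − (S(oT u v') − L³S₁u)| ≤ 100σN‖v̂'‖² + 10080αN‖v̂'‖² + N_pl(58752t³ + 1401138t⁴ + 10⁷αt²)`. [cite: Luscher1983, §3] -/
theorem abs_offMagnetic_le_near (u u' : GaugeConfig 3 1 SU2) {v' : Edge 3 L → Fin 3 → ℝ} (hv' : v' ∈ capBalancedSet L) {t σ α : ℝ} (ht : t ≤ 1 / 30) (hσ : σ < 2)
    (hS : (L : ℝ) ^ 3 * wilsonAction su2Rep u ≤ σ) (hS' : (L : ℝ) ^ 3 * wilsonAction su2Rep u' ≤ σ) (hv't : ∀ (e : Edge 3 L) (c : Fin 3), |v' e c| ≤ t)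
    (hα : α ≤ 1 / 30) (ha : ∀ k c, |vecPart (u (0, k) * (u' (0, k))⁻¹) c| ≤ α) (hw0 : ∀ k, 0 ≤ scalarPart (u (0, k) * (u' (0, k))⁻¹)) :
    |(wilsonAction su2Rep (orthoTube L u' v') - (L : ℝ) ^ 3 * wilsonAction su2Rep u') - (wilsonAction su2Rep (orthoTube L u v') - (L : ℝ) ^ 3 * wilsonAction su2Rep u)| ≤
      100 * σ * (Fintype.card (Plaquette 3 L × Fin 3) : ℝ) * ‖linkEmbed L v'‖ ^ 2 + 10080 * α * (Fintype.card (Plaquette 3 L × Fin 3) : ℝ) * ‖linkEmbed L v'‖ ^ 2 +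
        (Fintype.card (Plaquette 3 L) : ℝ) * (58752 * t ^ 3 + 1401138 * t ^ 4 + 10000000 * α * t ^ 2) := by
  have hv1 : ∀ e : Edge 3 L, ∑ a, v' e a ^ 2 ≤ 1 := sum_sq_le_one_of_cap L hv'.2
  have hSU : wilsonAction su2Rep (constLift L u) ≤ σ := by rw [wilsonAction_constLift_eq]; exact hS
  have hSU' : wilsonAction su2Rep (constLift L u') ≤ σ := by rw [wilsonAction_constLift_eq]; exact hS'
  set W : GaugeConfig 3 L SU2 := fun e => chartSU2 (v' e) with hW
  have hs : ∀ e : Edge 3 L, 0 ≤ scalarPart (W e) := fun e => by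
    show 0 ≤ scalarPart (chartSU2 (v' e)); rw [scalarPart_chartSU2 (hv1 e)]; exact Real.sqrt_nonneg _
  have hw : ∀ (e : Edge 3 L) (c : Fin 3), |vecPart (W e) c| ≤ t := fun e c => by
    show |vecPart (chartSU2 (v' e)) c| ≤ t; rw [vecPart_chartSU2 (hv1 e)]; exact hv't e c
  have hlv : linkVec L W = linkEmbed L v' := linkVec_chartSU2_eq_linkEmbed hv1
  -- the increments as plaquette sums
  have hinc : ∀ a : GaugeConfig 3 1 SU2, wilsonAction su2Rep (orthoTube L a v') - (L : ℝ) ^ 3 * wilsonAction su2Rep a =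
      ∑ p : Plaquette 3 L, (2 * (1 - scalarPart (transportStep W (constLift L a) p)) * scalarPart (hol (constLift L a) p) +
        2 * (vecPart (transportStep W (constLift L a) p) ⬝ᵥ vecPart (hol (constLift L a) p))) := fun a => by
    rw [← wilsonAction_constLift_eq, orthoTube_eq_mul_constLift, ← hW]; exact wilsonAction_step_eq W (constLift L a)
  -- no linear terms
  have hlin : ∀ a : GaugeConfig 3 1 SU2, ∑ p : Plaquette 3 L, ∑ c, covCurl (constLift L a) (linkVec L W) (p, c) * plaqCurv (constLift L a) (p, c) = 0 := fun a => by
    rw [sum_covCurl_mul_plaqCurv_eq_inner, hlv]; exact inner_covCurl_linkEmbed_plaqCurv_constLift_eq_zero a hv'.1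
  -- per-plaquette remainders (opaque name)
  obtain ⟨R, hR⟩ : ∃ R : GaugeConfig 3 1 SU2 → Plaquette 3 L → ℝ, R = fun a p =>
    (2 * (1 - scalarPart (transportStep W (constLift L a) p)) * scalarPart (hol (constLift L a) p) +
        2 * (vecPart (transportStep W (constLift L a) p) ⬝ᵥ vecPart (hol (constLift L a) p)))
      - 2 * ∑ c, covCurl (constLift L a) (linkVec L W) (p, c) * plaqCurv (constLift L a) (p, c)
      - scalarPart (hol (constLift L a) p) * ∑ c, covCurl (constLift L a) (linkVec L W) (p, c) ^ 2 := ⟨_, rfl⟩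
  have hdec : ∀ a : GaugeConfig 3 1 SU2, wilsonAction su2Rep (orthoTube L a v') - (L : ℝ) ^ 3 * wilsonAction su2Rep a =
      (∑ p, R a p) + ∑ p : Plaquette 3 L, scalarPart (hol (constLift L a) p) * ∑ c, covCurl (constLift L a) (linkVec L W) (p, c) ^ 2 := fun a => by
    rw [hinc a]
    have h0 := hlin a
    have e : ∀ p : Plaquette 3 L, (2 * (1 - scalarPart (transportStep W (constLift L a) p)) * scalarPart (hol (constLift L a) p) +
        2 * (vecPart (transportStep W (constLift L a) p) ⬝ᵥ vecPart (hol (constLift L a) p))) =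
        R a p + 2 * (∑ c, covCurl (constLift L a) (linkVec L W) (p, c) * plaqCurv (constLift L a) (p, c)) +
          scalarPart (hol (constLift L a) p) * ∑ c, covCurl (constLift L a) (linkVec L W) (p, c) ^ 2 := fun p => by
      simp only [hR]; ring
    rw [Finset.sum_congr rfl fun p _ => e p, Finset.sum_add_distrib, Finset.sum_add_distrib, ← Finset.mul_sum, h0, mul_zero, add_zero]
  rw [hdec u', hdec u]
  have e2 : ((∑ p, R u' p) + ∑ p : Plaquette 3 L, scalarPart (hol (constLift L u') p) * ∑ c, covCurl (constLift L u') (linkVec L W) (p, c) ^ 2) -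
      ((∑ p, R u p) + ∑ p : Plaquette 3 L, scalarPart (hol (constLift L u) p) * ∑ c, covCurl (constLift L u) (linkVec L W) (p, c) ^ 2) =
      (∑ p, (R u' p - R u p)) +
        ((∑ p : Plaquette 3 L, scalarPart (hol (constLift L u') p) * ∑ c, covCurl (constLift L u') (linkVec L W) (p, c) ^ 2) -
          ∑ p : Plaquette 3 L, scalarPart (hol (constLift L u) p) * ∑ c, covCurl (constLift L u) (linkVec L W) (p, c) ^ 2) := by
    have hs : (∑ p, (R u' p - R u p)) = (∑ p, R u' p) - ∑ p, R u p := Finset.sum_sub_distrib (fun p => R u' p) (fun p => R u p)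
    rw [hs]; ring
  rw [e2]
  have hRp : ∀ p, |R u' p - R u p| ≤ 58752 * t ^ 3 + 1401138 * t ^ 4 + 10000000 * α * t ^ 2 := fun p => by
    simp only [hR]; exact plaq_remainder_pair_le u u' W ht hσ hSU hSU' hs hw hα ha hw0 p
  have hRsum : |∑ p, (R u' p - R u p)| ≤ (Fintype.card (Plaquette 3 L) : ℝ) * (58752 * t ^ 3 + 1401138 * t ^ 4 + 10000000 * α * t ^ 2) := by
    refine (Finset.abs_sum_le_sum_abs _ _).trans ?_
    calc ∑ p : Plaquette 3 L, |R u' p - R u p| ≤ ∑ _p : Plaquette 3 L, (58752 * t ^ 3 + 1401138 * t ^ 4 + 10000000 * α * t ^ 2) := Finset.sum_le_sum fun p _ => hRp p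
      _ = (Fintype.card (Plaquette 3 L) : ℝ) * (58752 * t ^ 3 + 1401138 * t ^ 4 + 10000000 * α * t ^ 2) := by
        rw [Finset.sum_const, Finset.card_univ, nsmul_eq_mul]
  have hQd := abs_weightedStiffness_pair_le u u' (linkVec L W) hSU hSU' (by linarith) ha
  rw [hlv] at hQd
  have hQd' : |(∑ p : Plaquette 3 L, scalarPart (hol (constLift L u') p) * ∑ c, covCurl (constLift L u') (linkVec L W) (p, c) ^ 2) -
      ∑ p : Plaquette 3 L, scalarPart (hol (constLift L u) p) * ∑ c, covCurl (constLift L u) (linkVec L W) (p, c) ^ 2| ≤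
      100 * σ * (Fintype.card (Plaquette 3 L × Fin 3) : ℝ) * ‖linkEmbed L v'‖ ^ 2 + 10080 * α * (Fintype.card (Plaquette 3 L × Fin 3) : ℝ) * ‖linkEmbed L v'‖ ^ 2 := by
    rw [hlv]; exact hQd
  refine (abs_add_le _ _).trans ?_
  linarith

/-! ## §5 ★★★ The pointwise bound on `offX`, near-pair form with split radii -/

/-- ★★★ **POINTWISE BOUND ON THE OFF-DIAGONAL EXPONENT, NEAR-PAIR FORM** — `…SymmetricCorePair.abs_offX_le_split` with the magnetic remainder differenced: fibre coordinates at radius `t`,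
gauge/near-identity factors at radius `T ≥ t`, relative rotations `≤ α ≤ 1/30`:
`|offX| ≤ β(|E|(558α²T² + 192αT²) + 216ατ_uΓ) + (β/2)(100σN‖v̂'‖² + 10080αN‖v̂'‖² + N_pl(58752t³ + 1401138t⁴ + 10⁷αt²))`. [cite: Luscher1983, §3] -/
theorem abs_offX_le_near {β : ℝ} (hβ : 0 ≤ β) (u u' : GaugeConfig 3 1 SU2) {v v' : Edge 3 L → Fin 3 → ℝ} (hv : v ∈ capBalancedSet L) (hv' : v' ∈ capBalancedSet L)
    {t T σ α τu Γ : ℝ} (htT : t ≤ T) (hT : T ≤ 1 / 30) (hσ : σ < 2) (hS : (L : ℝ) ^ 3 * wilsonAction su2Rep u ≤ σ) (hS' : (L : ℝ) ^ 3 * wilsonAction su2Rep u' ≤ σ)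
    (hvt : ∀ (e : Edge 3 L) (c : Fin 3), |v e c| ≤ t) (hv't : ∀ (e : Edge 3 L) (c : Fin 3), |v' e c| ≤ t) {g : Site 3 L → SU2}
    (hg0 : ∀ x, 0 ≤ scalarPart (g x)) (hgT : ∀ x, ∑ c, vecPart (g x) c ^ 2 ≤ T ^ 2) (hΓ : ‖∑ x, vecPart (g x)‖ ≤ Γ) (hα : α ≤ 1 / 30)
    (ha : ∀ k c, |vecPart (u (0, k) * (u' (0, k))⁻¹) c| ≤ α) (hw0 : ∀ k, 0 ≤ scalarPart (u (0, k) * (u' (0, k))⁻¹)) (hu : ∀ k, ‖vecPart (u (0, k))‖ ≤ τu) :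
    |offX L β u u' v v' g| ≤
      β * ((Fintype.card (Edge 3 L) : ℝ) * (558 * α ^ 2 * T ^ 2 + 192 * α * T ^ 2) + 216 * α * τu * Γ) +
        β / 2 * (100 * σ * (Fintype.card (Plaquette 3 L × Fin 3) : ℝ) * ‖linkEmbed L v'‖ ^ 2 + 10080 * α * (Fintype.card (Plaquette 3 L × Fin 3) : ℝ) * ‖linkEmbed L v'‖ ^ 2 +
          (Fintype.card (Plaquette 3 L) : ℝ) * (58752 * t ^ 3 + 1401138 * t ^ 4 + 10000000 * α * t ^ 2)) := by
  have ht : t ≤ 1 / 30 := htT.trans hT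
  have hK := abs_offKinetic_le u u' hv hv' (by linarith) (fun e c => (hvt e c).trans htT) (fun e c => (hv't e c).trans htT) hg0 hgT hΓ ha hw0 hu
  have hM := abs_offMagnetic_le_near u u' hv' ht hσ hS hS' hv't hα ha hw0
  have e : offX L β u u' v v' g =
      β * ∑ e : Edge 3 L, 2 * ((scalarPart (u (0, e.2) * (u' (0, e.2))⁻¹) - 1) * (scalarPart (linkQ L u v v' g e) - 1) -
          vecPart (u (0, e.2) * (u' (0, e.2))⁻¹) ⬝ᵥ vecPart (linkQ L u v v' g e)) -
        β / 2 * ((wilsonAction su2Rep (orthoTube L u' v') - (L : ℝ) ^ 3 * wilsonAction su2Rep u') - (wilsonAction su2Rep (orthoTube L u v') - (L : ℝ) ^ 3 * wilsonAction su2Rep u)) := by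
    unfold offX; rw [offKinetic_eq]
  rw [e]
  refine (abs_sub _ _).trans ?_
  rw [abs_mul, abs_mul, abs_of_nonneg hβ, abs_of_nonneg (by linarith : (0 : ℝ) ≤ β / 2)]
  exact add_le_add (mul_le_mul_of_nonneg_left hK hβ) (mul_le_mul_of_nonneg_left hM (by linarith))

end Summit.QuantumFields.YangMills.Theorems.FemtoTransferGap.TwoLattice.ConstTube

end
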